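import Literature.Combinatorics.StablePolynomials.PartialSymmetrization
import Mathlib.RingTheory.MvPolynomial.Symmetric.Defs
import HarnessLib

/-!
# The symmetrization operator preserves stability of multi-affine polynomials (Borcea–Brändén II, Thm. 1.2 (a))

J. Borcea, P. Brändén, *The Lee–Yang and Pólya–Schur programs. II. Theory of stable polynomials and
applications*, Comm. Pure Appl. Math. 62 (2009) 1595–1631 (arXiv:0809.3087), §1:

> The symmetric group on `n` elements, `𝔖_n`, acts on `ℂ[z_1,…,z_n]` by permuting the variables:
> `σ(f)(z_1,…,z_n) = f(z_{σ(1)},…,z_{σ(n)})`. Define the symmetrization operator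
> `Sym : ℂ[z_1,…,z_n] → ℂ[z_1,…,z_n]` by `Sym(f) = (1/n!) Σ_{σ ∈ 𝔖_n} σ(f)`.
>
> **Theorem 1.2.** Let `C` be an open or closed circular domain. (a) If `C` is convex then the
> symmetrization operator `Sym` preserves `C`-stability on multi-affine polynomials […].

This file proves (a) for the open upper half-plane `C = H` (the tree's `IsUpperHalfPlaneStable`):
`IsUpperHalfPlaneStable.symmetrization` — if `f ∈ ℂ[z_σ]` is multi-affine and stable then `Sym f`
is stable — together with the real form `IsRealStable.symmetrization`. This is the input of the
authors' proof of the Grace–Walsh–Szegő coincidence theorem (loc. cit. §2, Thm. 2.1) and of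
Borcea–Brändén I, Prop. 2.4 (polarization preserves stability), see `GraceWalshSzego.lean`.

## The proof, and where it deviates from the printed one

The printed proof (§1, after Prop. 1.3, and the Appendix, Lemmas 9.1–9.2) writes `Sym(f)` as a
locally uniform *limit* of polynomials obtained from `f` by applying averages
`f ↦ (f + τ(f))/2` over transpositions `τ` infinitely often, and concludes with Prop. 1.3 (each such
average preserves stability of multi-affine polynomials — Borcea–Brändén–Liggett's Thm. 4.20, in the
tree as `IsUpperHalfPlaneStable.partialSymmetrization`) and the multivariate Hurwitz theorem.

Here the limit is replaced by an **exact finite scheme** ("random insertion"), which needs neither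
Hurwitz's theorem nor the symmetry index of Lemma 9.1: if `f` is symmetric in the variables of a
block `l = [j_1, …, j_m]` and `k ∉ l`, then

  `T_{j_m} ∘ ⋯ ∘ T_{j_1} (f) = (m+1)⁻¹ · (f + Σ_{j ∈ l} (j k)(f))`,
  `T_{j_i} = p_i · id + (1 - p_i) · (j_i k)`,  `p_i = (m+1-i)/(m+2-i) ∈ [0,1]`

(`insertionOp_apply_of_forall_rename_swap`; probabilistically: composing the lazy transpositions
`(j_1 k), …, (j_m k)` with these laziness parameters moves the letter `k` to a uniformly
distributed position of the block `l ∪ {k}`), and the right-hand side is symmetric in `l ∪ {k}`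
(`rename_swap_insertionOp`). Inserting the variables one at a time (`seqSymmetrization`) therefore
produces, by finitely many partial symmetrizations `θ·id + (1-θ)·τ` with `θ ∈ [0,1]`, a fully
symmetric polynomial `F` with `Sym F = Sym f`; as `Sym F = F`, this `F` *is* `Sym f`
(`seqSymmetrization_toList_univ`), and it is stable by Borcea–Brändén–Liggett's theorem applied
`n(n-1)/2` times.

## Main results (namespace `Literature.Combinatorics.StablePolynomials`)

* `symmetrization` — `Sym f = (n!)⁻¹ Σ_{π ∈ 𝔖_σ} π(f)` as a `K`-linear operator on `MvPolynomial σ K`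
  (`K` a field); `rename_symmetrization` (`Sym f` is symmetric, `symmetrization_isSymmetric`),
  `symmetrization_rename` (`Sym (π f) = Sym f`), `symmetrization_eq_self` (`Sym f = f` for symmetric
  `f`), `eval_const_symmetrization` (`Sym` does not change the diagonal `f(t,…,t)`),
  `IsMultiAffine.symmetrization`.
* `insertionOp`, `insertionOp_apply_of_forall_rename_swap`, `rename_swap_insertionOp` — the random
  insertion scheme and its closed form; `symmetrization_eq_smul_sum_swap` — for `f` symmetric in all
  variables but `k`: `Sym f = n⁻¹ (f + Σ_{i ≠ k} (i k) f)`.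
* `seqSymmetrization`, `seqSymmetrization_toList_univ` — `Sym` as a finite composite of partial
  symmetrizations.
* `IsUpperHalfPlaneStable.symmetrization` — **Thm. 1.2 (a)** for `H`; `IsRealStable.symmetrization`.

## Mathlib / tree search

REUSED: tree `IsUpperHalfPlaneStable.partialSymmetrization` (BBL Thm. 4.20), `IsMultiAffine`,
`IsRealStable`; Mathlib `MvPolynomial.rename`, `MvPolynomial.IsSymmetric`, `Equiv.swap`,
`Equiv.mul_swap_eq_swap_mul`, `Equiv.Perm.swap_induction_on`, `Fintype.card_perm`. Mathlib has no
symmetrization operator on `MvPolynomial` (searched `symmetriz`, `Reynolds`): the Reynolds-operator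
material of `Mathlib.RepresentationTheory` is not specialised to the permutation action on variables.

## References

* J. Borcea, P. Brändén, *The Lee–Yang and Pólya–Schur programs. II. Theory of stable polynomials and
  applications*, Comm. Pure Appl. Math. 62 (2009) 1595–1631; arXiv:0809.3087: §1 (definition of
  `Sym`, Thm. 1.2, Prop. 1.3, proof of Thm. 1.2), §9 Appendix (Lemmas 9.1, 9.2). [BorceaBranden2009II]
* J. Borcea, P. Brändén, T. M. Liggett, *Negative dependence and the geometry of polynomials*,
  J. Amer. Math. Soc. 22 (2009) 521–567, §4.3 Thm. 4.20 (partial symmetrization).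
  [BorceaBrandenLiggett2007]
* J. Borcea, P. Brändén, *The Lee–Yang and Pólya–Schur programs. I*, Invent. Math. 177 (2009)
  541–569, §2.2 (symmetrization `Π↑_κ ∘ Π↓_κ`, Prop. 2.4). [BorceaBranden2009]
-/

noncomputable section

open MvPolynomial Finset

namespace Literature.Combinatorics.StablePolynomials

variable {σ : Type*}

/-! ## §1 Renaming by permutations; multi-affinity under linear operations -/

section Rename

variable {R : Type*} [CommSemiring R]

/-- Renaming by a product of permutations is the composite of the renamings:
`(π π')(f) = π(π'(f))` (the action of `𝔖_n` on `ℂ[z_1,…,z_n]` by permuting the variables).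
[cite: BorceaBranden2009II, §1 (the action σ(f)(z) = f(z_{σ(1)},…,z_{σ(n)}))] -/
theorem rename_perm_mul (e e' : Equiv.Perm σ) (f : MvPolynomial σ R) :
    rename (⇑(e * e')) f = rename e (rename e' f) := by
  rw [rename_rename, Equiv.Perm.coe_mul]

/-- Renaming by the identity permutation. [cite: BorceaBranden2009II, §1 (the action of `𝔖_n` on
`ℂ[z_1,…,z_n]`)] -/
theorem rename_perm_one (f : MvPolynomial σ R) : rename (⇑(1 : Equiv.Perm σ)) f = f := by
  rw [Equiv.Perm.coe_one, rename_id_apply]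

/-- A polynomial invariant under all transpositions of a finite set of variables is invariant under
all permutations (the transpositions generate `𝔖_n`). [cite: BorceaBranden2009II, §9 Appendix,
proof of Lemma 9.2 ("`τ(g) = g` for all transpositions `τ ∈ 𝔖_n` and thus `g = Sym(f)`")] -/
theorem rename_perm_eq_self_of_forall_swap [DecidableEq σ] [Finite σ] {f : MvPolynomial σ R}
    (hf : ∀ a b : σ, rename (Equiv.swap a b) f = f) (e : Equiv.Perm σ) : rename e f = f := by
  induction e using Equiv.Perm.swap_induction_on with
  | one => exact rename_perm_one f
  | swap_mul g x y _ ih => rw [rename_perm_mul, ih, hf]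

/-- Evaluating a renamed polynomial on the diagonal `(t, …, t)`: `π(f)(t,…,t) = f(t,…,t)`.
[cite: BorceaBranden2009, §2.2 (b) (setting all variables equal undoes the permutation)] -/
theorem eval_const_rename_perm (e : Equiv.Perm σ) (t : R) (f : MvPolynomial σ R) :
    eval (fun _ : σ => t) (rename e f) = eval (fun _ : σ => t) f := by
  rw [eval_rename]
  rfl

/-- `0` is multi-affine. [cite: BorceaBranden2009, §2.1 (multi-affine: degree at most one in each
variable)] -/
theorem isMultiAffine_zero : IsMultiAffine (0 : MvPolynomial σ R) := fun i => by
  rw [degreeOf_zero]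
  exact Nat.zero_le _

/-- Constants are multi-affine. [cite: BorceaBranden2009, §2.1 (definition of multi-affine)] -/
theorem isMultiAffine_C (c : R) : IsMultiAffine (C c : MvPolynomial σ R) := fun i => by
  rw [degreeOf_C]
  exact Nat.zero_le _

/-- Sums of multi-affine polynomials are multi-affine (`ℂ_{(1ⁿ)}[z]` is a linear space).
[cite: BorceaBranden2009, §2.1 (the space `ℂ_κ[z_1,…,z_n]`, κ = (1,…,1))] -/
theorem IsMultiAffine.add {f g : MvPolynomial σ R} (hf : IsMultiAffine f) (hg : IsMultiAffine g) :
    IsMultiAffine (f + g) := fun i =>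
  (degreeOf_add_le i f g).trans (max_le (hf i) (hg i))

/-- Scalar multiples of multi-affine polynomials are multi-affine.
[cite: BorceaBranden2009, §2.1 (the space `ℂ_κ[z_1,…,z_n]`, κ = (1,…,1))] -/
theorem IsMultiAffine.smul {f : MvPolynomial σ R} (hf : IsMultiAffine f) (c : R) :
    IsMultiAffine (c • f) := fun i => by
  rw [smul_eq_C_mul]
  exact (degreeOf_C_mul_le f i c).trans (hf i)

/-- Finite sums of multi-affine polynomials are multi-affine.
[cite: BorceaBranden2009, §2.1 (the space `ℂ_κ[z_1,…,z_n]`, κ = (1,…,1))] -/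
theorem IsMultiAffine.sum {ι : Type*} (s : Finset ι) {f : ι → MvPolynomial σ R}
    (h : ∀ i ∈ s, IsMultiAffine (f i)) : IsMultiAffine (∑ i ∈ s, f i) := by
  classical
  induction s using Finset.induction_on with
  | empty => rw [sum_empty]; exact isMultiAffine_zero
  | insert a s ha ih =>
    rw [sum_insert ha]
    exact (h a (mem_insert_self a s)).add (ih fun i hi => h i (mem_insert_of_mem hi))

/-- Renaming along an equivalence of variables preserves multi-affinity (`𝔖_n` acts on
`ℂ_{(1ⁿ)}[z_1,…,z_n]`). [cite: BorceaBranden2009II, §1 Thm. 1.2 (Sym acts on ℂ_{(1ⁿ)}[z_1,…,z_n])] -/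
theorem IsMultiAffine.rename_equiv {τ : Type*} {f : MvPolynomial σ R} (hf : IsMultiAffine f)
    (e : σ ≃ τ) : IsMultiAffine (rename e f) := fun i => by
  obtain ⟨j, rfl⟩ := e.surjective i
  rw [degreeOf_rename_of_injective e.injective]
  exact hf j

end Rename

/-! ## §2 The symmetrization operator `Sym` -/

section Sym

variable {K : Type*} [Field K] [Fintype σ] [DecidableEq σ]

/-- **The symmetrization operator** (Borcea–Brändén II, §1): "`Sym(f) = (1/n!) Σ_{σ ∈ 𝔖_n} σ(f)`",
where `σ(f)(z_1,…,z_n) = f(z_{σ(1)},…,z_{σ(n)})` is `rename σ f`; a `K`-linear operator on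
`MvPolynomial σ K` (`n! = |𝔖_σ| = Fintype.card (Equiv.Perm σ)`). [cite: BorceaBranden2009II, §1
(definition of Sym, before Thm. 1.1)] -/
def symmetrization : MvPolynomial σ K →ₗ[K] MvPolynomial σ K :=
  ((Fintype.card (Equiv.Perm σ) : K)⁻¹) •
    ∑ e : Equiv.Perm σ, (rename (⇑e) : MvPolynomial σ K →ₐ[K] MvPolynomial σ K).toLinearMap

/-- `Sym f = (n!)⁻¹ Σ_π π(f)`. [cite: BorceaBranden2009II, §1 (definition of Sym)] -/
theorem symmetrization_apply (f : MvPolynomial σ K) :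
    symmetrization f = ((Fintype.card (Equiv.Perm σ) : K)⁻¹) • ∑ e : Equiv.Perm σ, rename (⇑e) f := by
  rw [symmetrization, LinearMap.smul_apply, LinearMap.sum_apply]
  rfl

/-- `n! ≠ 0` in a field of characteristic zero. [folklore] -/
private theorem card_perm_ne_zero [CharZero K] : (Fintype.card (Equiv.Perm σ) : K) ≠ 0 :=
  Nat.cast_ne_zero.2 Fintype.card_ne_zero

/-- **`Sym f` is symmetric**: `π(Sym f) = Sym f` for every permutation `π` ("`Sym` is a linear
operator whose image consists of symmetric polynomials"). [cite: BorceaBranden2009II, §1 (after the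
definition of Sym)] -/
theorem rename_symmetrization (e : Equiv.Perm σ) (f : MvPolynomial σ K) :
    rename (⇑e) (symmetrization f) = symmetrization f := by
  rw [symmetrization_apply, map_smul, map_sum]
  congr 1
  simp_rw [← rename_perm_mul]
  exact Equiv.sum_comp (Equiv.mulLeft e) (fun e'' : Equiv.Perm σ => rename (⇑e'') f)

/-- `Sym f` is a symmetric polynomial in Mathlib's sense (`MvPolynomial.IsSymmetric`).
[cite: BorceaBranden2009II, §1 (after the definition of Sym)] -/
theorem symmetrization_isSymmetric (f : MvPolynomial σ K) : (symmetrization f).IsSymmetric :=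
  fun e => rename_symmetrization e f

/-- **`Sym` absorbs permutations**: `Sym (π f) = Sym f`. [cite: BorceaBranden2009II, §1 (definition
of Sym)] -/
theorem symmetrization_rename (e : Equiv.Perm σ) (f : MvPolynomial σ K) :
    symmetrization (rename (⇑e) f) = symmetrization f := by
  rw [symmetrization_apply, symmetrization_apply]
  congr 1
  simp_rw [← rename_perm_mul]
  exact Equiv.sum_comp (Equiv.mulRight e) (fun e'' : Equiv.Perm σ => rename (⇑e'') f)

/-- `Sym` absorbs transpositions: `Sym ((a b) f) = Sym f`. [cite: BorceaBranden2009II, §1] -/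
theorem symmetrization_rename_swap (a b : σ) (f : MvPolynomial σ K) :
    symmetrization (rename (Equiv.swap a b) f) = symmetrization f :=
  symmetrization_rename (Equiv.swap a b) f

/-- **`Sym f = f` for a symmetric polynomial** (characteristic zero). [cite: BorceaBranden2009II, §1
(the image of Sym consists of the symmetric polynomials)] -/
theorem symmetrization_eq_self [CharZero K] {f : MvPolynomial σ K}
    (hf : ∀ e : Equiv.Perm σ, rename (⇑e) f = f) : symmetrization f = f := by
  rw [symmetrization_apply]
  simp_rw [hf]
  rw [sum_const, card_univ, ← Nat.cast_smul_eq_nsmul K, smul_smul, inv_mul_cancel₀ card_perm_ne_zero,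
    one_smul]

/-- `Sym f = f` for `f` symmetric in Mathlib's sense. [cite: BorceaBranden2009II, §1] -/
theorem _root_.MvPolynomial.IsSymmetric.symmetrization_eq [CharZero K] {f : MvPolynomial σ K}
    (hf : f.IsSymmetric) : symmetrization f = f :=
  symmetrization_eq_self hf

/-- `Sym` is idempotent. [cite: BorceaBranden2009II, §1] -/
theorem symmetrization_symmetrization [CharZero K] (f : MvPolynomial σ K) :
    symmetrization (symmetrization f) = symmetrization f :=
  symmetrization_eq_self (rename_symmetrization · f)

/-- `Sym` fixes constants. [cite: BorceaBranden2009II, §1 (definition of Sym)] -/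
theorem symmetrization_C [CharZero K] (c : K) : symmetrization (C c : MvPolynomial σ K) = C c :=
  symmetrization_eq_self fun e => rename_C (⇑e) c

/-- **`Sym` does not change the diagonal**: `(Sym f)(t,…,t) = f(t,…,t)`.
[cite: BorceaBranden2009, §2.2 (b) (`Π↓ ∘ Π↑ = id`: the diagonal is unchanged by symmetrizing)] -/
theorem eval_const_symmetrization [CharZero K] (t : K) (f : MvPolynomial σ K) :
    eval (fun _ : σ => t) (symmetrization f) = eval (fun _ : σ => t) f := by
  rw [symmetrization_apply, smul_eval, map_sum]
  simp_rw [eval_const_rename_perm]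
  rw [sum_const, card_univ, nsmul_eq_mul, ← mul_assoc, inv_mul_cancel₀ card_perm_ne_zero, one_mul]

/-- `Sym` of a multi-affine polynomial is multi-affine (Thm. 1.2 is about `Sym` *on* multi-affine
polynomials: "`Sym : ℂ_{(1ⁿ)}[z_1,…,z_n] → ℂ_{(1ⁿ)}[z_1,…,z_n]`"). [cite: BorceaBranden2009II, §1
Thm. 1.2 (a)] -/
theorem IsMultiAffine.symmetrization {f : MvPolynomial σ K} (hf : IsMultiAffine f) :
    IsMultiAffine (StablePolynomials.symmetrization f) := by
  rw [symmetrization_apply]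
  exact (IsMultiAffine.sum _ fun e _ => hf.rename_equiv e).smul _

end Sym

/-! ## §3 Random insertion: an exact finite scheme of partial symmetrizations -/

section Insertion

variable [DecidableEq σ]

/-- **Random insertion of the variable `k` into the block `l = [j_1, …, j_m]`**: the composite
`T_{j_m} ∘ ⋯ ∘ T_{j_1}` of the partial symmetrizations (Borcea–Brändén–Liggett's operators, tree
`partialSymmetrization θ τ = θ·id + (1-θ)·rename τ`)
`T_{j_i} = p_i · id + (1 - p_i) · (j_i k)` with `p_i = (m+1-i)/(m+2-i)`, i.e. the first factor
applied has `p = m/(m+1)` and the last `p = 1/2`. Defined by recursion on `l`: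
`insertionOp k (j :: l) = insertionOp k l ∘ T_j` with `p = (|l|+1)/(|l|+2)`. This replaces the
infinite product of Appendix Lemma 9.2. [cite: BorceaBranden2009II, §1 Prop. 1.3 and §9 Appendix
(Lemma 9.2: `Sym` via transposition averages)] -/
def insertionOp (k : σ) : List σ → (MvPolynomial σ ℂ →ₗ[ℂ] MvPolynomial σ ℂ)
  | [] => LinearMap.id
  | j :: l => insertionOp k l ∘ₗ
      partialSymmetrization (((l.length + 1 : ℕ) : ℂ) / ((l.length + 2 : ℕ) : ℂ)) (Equiv.swap j k)

/-- No block: nothing to do. [cite: BorceaBranden2009II, §9 Appendix] -/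
@[simp] theorem insertionOp_nil (k : σ) (f : MvPolynomial σ ℂ) : insertionOp k [] f = f := rfl

/-- One step of the insertion scheme:
`insertionOp k (j :: l) f = insertionOp k l (p f + (1-p) (j k) f)`, `p = (|l|+1)/(|l|+2)`.
[cite: BorceaBranden2009II, §1 Prop. 1.3 (the operator `p f + (1-p) τ(f)`)] -/
theorem insertionOp_cons (k j : σ) (l : List σ) (f : MvPolynomial σ ℂ) :
    insertionOp k (j :: l) f = insertionOp k l
      ((((l.length + 1 : ℕ) : ℂ) / ((l.length + 2 : ℕ) : ℂ)) • f +
        (1 - ((l.length + 1 : ℕ) : ℂ) / ((l.length + 2 : ℕ) : ℂ)) • rename (Equiv.swap j k) f) := by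
  rw [insertionOp, LinearMap.comp_apply, partialSymmetrization_apply]

/-- A polynomial fixed by every transposition `(i k)`, `i ∈ l`, is fixed by the insertion scheme
(each step `p g + (1-p) τ(g)` returns `g` when `τ(g) = g`). [cite: BorceaBranden2009II, §9 Appendix,
Lemma 9.1 (equality case: `T_σ(f) = f`)] -/
theorem insertionOp_eq_self_of_forall (k : σ) {l : List σ} {g : MvPolynomial σ ℂ}
    (hg : ∀ i ∈ l, rename (Equiv.swap i k) g = g) : insertionOp k l g = g := by
  induction l with
  | nil => rfl
  | cons j l ih =>
    rw [insertionOp_cons, hg j List.mem_cons_self, ← add_smul, add_sub_cancel, one_smul]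
    exact ih fun i hi => hg i (List.mem_cons_of_mem j hi)

/-- Conjugating `(j k)` by `(i k)`: for pairwise distinct `i, j, k`,
`(i k)(j k) = (j k)(i j)` in `𝔖_σ`. [folklore] -/
private theorem swap_mul_swap_eq_swap_mul_swap {i j k : σ} (hij : i ≠ j) (hik : i ≠ k) :
    Equiv.swap i k * Equiv.swap j k = Equiv.swap j k * Equiv.swap i j := by
  conv_lhs => rw [Equiv.swap_mul_eq_mul_swap]
  rw [Equiv.swap_inv, Equiv.swap_apply_of_ne_of_ne hij hik, Equiv.swap_apply_right]

/-- **The random-insertion identity.** If `f` is invariant under the transpositions of the block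
`l` (no repetitions, `k ∉ l`, `|l| = m`), then
`insertionOp k l f = (m+1)⁻¹ · (f + Σ_{i ∈ l} (i k) f)`: the composite of the lazy transpositions
`(j_1 k), …, (j_m k)` with laziness `p_i = (m+1-i)/(m+2-i)` sends the letter `k` to each of the
`m+1` positions of the block `l ∪ {k}` with the same weight. This exact identity replaces the
limit of Appendix Lemma 9.2 ("`Sym(f)` can be achieved by applying `f ↦ (f + τ(f))/2` infinitely
many times with different transpositions `τ`"). [cite: BorceaBranden2009II, §9 Appendix, Lemma 9.2
(statement replaced by a finite scheme)] -/
theorem insertionOp_apply_of_forall_rename_swap {k : σ} {l : List σ} (hl : l.Nodup) (hk : k ∉ l)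
    {f : MvPolynomial σ ℂ} (hf : ∀ i ∈ l, ∀ j ∈ l, rename (Equiv.swap i j) f = f) :
    insertionOp k l f =
      (((l.length + 1 : ℕ) : ℂ))⁻¹ • (f + ∑ i ∈ l.toFinset, rename (Equiv.swap i k) f) := by
  induction l with
  | nil => simp
  | cons j l ih =>
    have hjl : j ∉ l := (List.nodup_cons.1 hl).1
    have hl' : l.Nodup := (List.nodup_cons.1 hl).2
    have hkj : k ≠ j := fun h => hk (h ▸ List.mem_cons_self)
    have hkl : k ∉ l := fun h => hk (List.mem_cons_of_mem j h)
    -- the transposed polynomial `(j k) f` is fixed by every `(i k)`, `i ∈ l`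
    have hfix : ∀ i ∈ l, rename (Equiv.swap i k) (rename (Equiv.swap j k) f) =
        rename (Equiv.swap j k) f := by
      intro i hi
      have hij : i ≠ j := fun h => hjl (h ▸ hi)
      have hik : i ≠ k := fun h => hkl (h ▸ hi)
      rw [← rename_perm_mul, swap_mul_swap_eq_swap_mul_swap hij hik, rename_perm_mul,
        hf i (List.mem_cons_of_mem j hi) j List.mem_cons_self]
    rw [insertionOp_cons, map_add, map_smul, map_smul, insertionOp_eq_self_of_forall k hfix,
      ih hl' hkl fun i hi i' hi' => hf i (List.mem_cons_of_mem j hi) i' (List.mem_cons_of_mem j hi'),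
      smul_smul, List.toFinset_cons, sum_insert (fun h => hjl (List.mem_toFinset.1 h)),
      List.length_cons]
    have h1 : ((l.length + 1 : ℕ) : ℂ) ≠ 0 := Nat.cast_ne_zero.2 (Nat.succ_ne_zero _)
    have h2 : ((l.length + 2 : ℕ) : ℂ) ≠ 0 := Nat.cast_ne_zero.2 (Nat.succ_ne_zero _)
    have e1 : ((l.length + 1 : ℕ) : ℂ) / ((l.length + 2 : ℕ) : ℂ) * (((l.length + 1 : ℕ) : ℂ))⁻¹ =
        (((l.length + 1 + 1 : ℕ) : ℂ))⁻¹ := by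
      rw [show l.length + 1 + 1 = l.length + 2 from rfl]
      field_simp
    have e2 : 1 - ((l.length + 1 : ℕ) : ℂ) / ((l.length + 2 : ℕ) : ℂ) =
        (((l.length + 1 + 1 : ℕ) : ℂ))⁻¹ := by
      rw [show l.length + 1 + 1 = l.length + 2 from rfl]
      field_simp
      push_cast
      ring
    rw [e1, e2, ← smul_add]
    congr 1
    abel

/-- Transpositions inside a finite set permute it. [folklore] -/
private theorem swap_apply_mem_of_mem {S : Finset σ} {a b : σ} (ha : a ∈ S) (hb : b ∈ S) {i : σ}
    (hi : i ∈ S) : Equiv.swap a b i ∈ S := by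
  rw [Equiv.swap_apply_def]
  split_ifs <;> assumption

/-- Transpositions inside a finite set permute it (iff form). [folklore] -/
private theorem swap_apply_mem_iff {S : Finset σ} {a b : σ} (ha : a ∈ S) (hb : b ∈ S) (i : σ) :
    i ∈ S ↔ Equiv.swap a b i ∈ S := by
  refine ⟨swap_apply_mem_of_mem ha hb, fun h => ?_⟩
  have := swap_apply_mem_of_mem ha hb h
  rwa [Equiv.swap_apply_self] at this

/-- **The inserted polynomial is symmetric in the enlarged block**: under the hypotheses of the
random-insertion identity, `insertionOp k l f` is invariant under every transposition of
`l ∪ {k}`. [cite: BorceaBranden2009II, §9 Appendix, Lemma 9.2 (its rôle: the iterated averages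
symmetrize)] -/
theorem rename_swap_insertionOp {k : σ} {l : List σ} (hl : l.Nodup) (hk : k ∉ l)
    {f : MvPolynomial σ ℂ} (hf : ∀ i ∈ l, ∀ j ∈ l, rename (Equiv.swap i j) f = f)
    {a b : σ} (ha : a ∈ k :: l) (hb : b ∈ k :: l) :
    rename (Equiv.swap a b) (insertionOp k l f) = insertionOp k l f := by
  -- the symmetric expression `F₀ = f + Σ_{i ∈ l} (i k) f`
  set S := l.toFinset with hS
  have hmem : ∀ {i}, i ∈ S ↔ i ∈ l := fun {i} => List.mem_toFinset
  have hkS : k ∉ S := fun h => hk (hmem.1 h)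
  -- (iii) invariance under `(a k)`, `a ∈ l`
  have key : ∀ {a}, a ∈ l → rename (Equiv.swap a k) (f + ∑ i ∈ S, rename (Equiv.swap i k) f) =
      f + ∑ i ∈ S, rename (Equiv.swap i k) f := by
    intro a hal
    have haS : a ∈ S := hmem.2 hal
    have hak : a ≠ k := fun h => hkS (h ▸ haS)
    rw [map_add, map_sum, ← add_sum_erase S _ haS, ← add_sum_erase S _ haS, ← rename_perm_mul,
      Equiv.swap_mul_self, rename_perm_one]
    have hrest : ∀ i ∈ S.erase a, rename (Equiv.swap a k) (rename (Equiv.swap i k) f) =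
        rename (Equiv.swap i k) f := by
      intro i hi
      have hia : i ≠ a := (mem_erase.1 hi).1
      have hiS : i ∈ S := (mem_erase.1 hi).2
      have hik : i ≠ k := fun h => hkS (h ▸ hiS)
      rw [← rename_perm_mul, swap_mul_swap_eq_swap_mul_swap hia.symm hak, rename_perm_mul,
        hf a hal i (hmem.1 hiS)]
    rw [sum_congr rfl hrest]
    abel
  rw [insertionOp_apply_of_forall_rename_swap hl hk hf, map_smul]
  congr 1
  rcases List.mem_cons.1 ha with rfl | hal <;> rcases List.mem_cons.1 hb with rfl | hbl
  · -- `a = b = k`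
    rw [Equiv.swap_self, Equiv.coe_refl, rename_id_apply]
  · -- `(k b)`, `b ∈ l`
    rw [Equiv.swap_comm]
    exact key hbl
  · -- `(a k)`, `a ∈ l`
    exact key hal
  · -- `(a b)`, `a, b ∈ l`
    have haS : a ∈ S := hmem.2 hal
    have hbS : b ∈ S := hmem.2 hbl
    have hka : k ≠ a := fun h => hkS (h ▸ haS)
    have hkb : k ≠ b := fun h => hkS (h ▸ hbS)
    rw [map_add, map_sum, hf a hal b hbl]
    congr 1
    symm
    refine sum_equiv (Equiv.swap a b) (fun i => swap_apply_mem_iff haS hbS i) fun i _ => ?_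
    rw [← rename_perm_mul, Equiv.mul_swap_eq_swap_mul, Equiv.swap_apply_self,
      Equiv.swap_apply_of_ne_of_ne hka hkb, rename_perm_mul, hf a hal b hbl]

variable [Fintype σ]

/-- `Sym` is unchanged by the insertion scheme: `Sym (insertionOp k l f) = Sym f` (each step is an
affine combination of `g` and a transposition of `g`). [cite: BorceaBranden2009II, §1 (Sym) and §9
Appendix] -/
theorem symmetrization_insertionOp (k : σ) (l : List σ) (f : MvPolynomial σ ℂ) :
    symmetrization (insertionOp k l f) = symmetrization f := by
  induction l generalizing f with
  | nil => rfl
  | cons j l ih =>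
    rw [insertionOp_cons, ih, map_add, map_smul, map_smul, symmetrization_rename_swap, ← add_smul,
      add_sub_cancel, one_smul]

/-- **Coset formula for `Sym`**: if `f` is invariant under the transpositions not involving the
variable `k`, then `Sym f = n⁻¹ · (f + Σ_{i ≠ k} (i k) f)` (`n = |σ|`), the average over the coset
representatives `(i k)` of `𝔖_{n-1}` in `𝔖_n`. [cite: BorceaBranden2009II, §1 (definition of Sym)] -/
theorem symmetrization_eq_smul_sum_swap {k : σ} {f : MvPolynomial σ ℂ}
    (hf : ∀ i, i ≠ k → ∀ j, j ≠ k → rename (Equiv.swap i j) f = f) :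
    symmetrization f =
      ((Fintype.card σ : ℂ))⁻¹ • (f + ∑ i ∈ univ.erase k, rename (Equiv.swap i k) f) := by
  set l := (univ.erase k).toList with hl
  have hln : l.Nodup := nodup_toList _
  have hkl : k ∉ l := fun h => (mem_erase.1 (mem_toList.1 h)).1 rfl
  have hf' : ∀ i ∈ l, ∀ j ∈ l, rename (Equiv.swap i j) f = f := fun i hi j hj =>
    hf i (mem_erase.1 (mem_toList.1 hi)).1 j (mem_erase.1 (mem_toList.1 hj)).1
  have hall : ∀ a : σ, a ∈ k :: l := fun a => by
    by_cases h : a = k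
    · exact h ▸ List.mem_cons_self
    · exact List.mem_cons_of_mem k (mem_toList.2 (mem_erase.2 ⟨h, mem_univ a⟩))
  -- `F = insertionOp k l f` is fully symmetric, hence `F = Sym F = Sym f`
  have hF : ∀ e : Equiv.Perm σ, rename (⇑e) (insertionOp k l f) = insertionOp k l f :=
    rename_perm_eq_self_of_forall_swap fun a b => rename_swap_insertionOp hln hkl hf' (hall a) (hall b)
  rw [← symmetrization_insertionOp k l f, symmetrization_eq_self hF,
    insertionOp_apply_of_forall_rename_swap hln hkl hf', toList_toFinset, length_toList,
    card_erase_of_mem (mem_univ k), card_univ, Nat.sub_add_cancel (Fintype.card_pos_iff.2 ⟨k⟩)]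

end Insertion

/-! ## §4 `Sym` as a finite composite of partial symmetrizations -/

section Sequential

variable [DecidableEq σ]

/-- **Sequential symmetrization**: insert the variables of `l` one at a time,
`seqSymmetrization (k :: l) = insertionOp k l ∘ seqSymmetrization l`; a finite composite of
partial symmetrizations `θ·id + (1-θ)·τ`, `θ ∈ [0,1]`. [cite: BorceaBranden2009II, §1 proof of
Thm. 1.2 and §9 Appendix, Lemma 9.2] -/
def seqSymmetrization : List σ → (MvPolynomial σ ℂ →ₗ[ℂ] MvPolynomial σ ℂ)
  | [] => LinearMap.id
  | k :: l => insertionOp k l ∘ₗ seqSymmetrization l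

/-- No variables: identity. [cite: BorceaBranden2009II, §9 Appendix (the empty product of
`T_τ`'s)] -/
@[simp] theorem seqSymmetrization_nil (f : MvPolynomial σ ℂ) : seqSymmetrization [] f = f := rfl

/-- One more variable. [cite: BorceaBranden2009II, §9 Appendix] -/
theorem seqSymmetrization_cons (k : σ) (l : List σ) (f : MvPolynomial σ ℂ) :
    seqSymmetrization (k :: l) f = insertionOp k l (seqSymmetrization l f) := rfl

/-- **The sequentially symmetrized polynomial is symmetric in the processed variables.**
[cite: BorceaBranden2009II, §9 Appendix, Lemma 9.2 (rôle)] -/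
theorem rename_swap_seqSymmetrization {l : List σ} (hl : l.Nodup) (f : MvPolynomial σ ℂ) {a b : σ}
    (ha : a ∈ l) (hb : b ∈ l) :
    rename (Equiv.swap a b) (seqSymmetrization l f) = seqSymmetrization l f := by
  induction l generalizing a b with
  | nil => exact absurd ha List.not_mem_nil
  | cons k l ih =>
    have hkl : k ∉ l := (List.nodup_cons.1 hl).1
    have hl' : l.Nodup := (List.nodup_cons.1 hl).2
    rw [seqSymmetrization_cons]
    exact rename_swap_insertionOp hl' hkl (fun i hi j hj => ih hl' hi hj) ha hb

variable [Fintype σ]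

/-- `Sym (seqSymmetrization l f) = Sym f`. [cite: BorceaBranden2009II, §1 and §9 Appendix] -/
theorem symmetrization_seqSymmetrization (l : List σ) (f : MvPolynomial σ ℂ) :
    symmetrization (seqSymmetrization l f) = symmetrization f := by
  induction l with
  | nil => rfl
  | cons k l ih => rw [seqSymmetrization_cons, symmetrization_insertionOp, ih]

/-- **`Sym` is a finite composite of partial symmetrizations**: processing all the variables (in the
order of `univ.toList`) yields exactly `Sym f` — the finite substitute for Appendix Lemma 9.2
("`Sym(f) ∈` the closure of `Trp(f)`"). [cite: BorceaBranden2009II, §9 Appendix, Lemma 9.2] -/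
theorem seqSymmetrization_toList_univ (f : MvPolynomial σ ℂ) :
    seqSymmetrization (univ : Finset σ).toList f = symmetrization f := by
  have hF : ∀ e : Equiv.Perm σ, rename (⇑e) (seqSymmetrization (univ : Finset σ).toList f) =
      seqSymmetrization (univ : Finset σ).toList f :=
    rename_perm_eq_self_of_forall_swap fun a b =>
      rename_swap_seqSymmetrization (nodup_toList _) f (mem_toList.2 (mem_univ a))
        (mem_toList.2 (mem_univ b))
  rw [← symmetrization_eq_self hF, symmetrization_seqSymmetrization]

end Sequential

/-! ## §5 Theorem 1.2 (a): `Sym` preserves stability of multi-affine polynomials -/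

section Stability

variable [Fintype σ] [DecidableEq σ]

/-- One partial symmetrization with a rational laziness parameter `(m+1)/(m+2) ∈ [0,1]` keeps a
multi-affine polynomial multi-affine and stable (Borcea–Brändén–Liggett Thm. 4.20 / BB-II Prop. 1.3
(a), tree `IsUpperHalfPlaneStable.partialSymmetrization`). [cite: BorceaBranden2009II, §1 Prop. 1.3
(a)] [cite: BorceaBrandenLiggett2007, §4.3 Thm. 4.20] -/
theorem IsUpperHalfPlaneStable.partialSymmetrization_nat {f : MvPolynomial σ ℂ} (hf : IsMultiAffine f)
    (hs : IsUpperHalfPlaneStable f) (j k : σ) (m : ℕ) :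
    IsMultiAffine ((((m + 1 : ℕ) : ℂ) / ((m + 2 : ℕ) : ℂ)) • f +
        (1 - ((m + 1 : ℕ) : ℂ) / ((m + 2 : ℕ) : ℂ)) • MvPolynomial.rename (Equiv.swap j k) f) ∧
      IsUpperHalfPlaneStable ((((m + 1 : ℕ) : ℂ) / ((m + 2 : ℕ) : ℂ)) • f +
        (1 - ((m + 1 : ℕ) : ℂ) / ((m + 2 : ℕ) : ℂ)) • MvPolynomial.rename (Equiv.swap j k) f) := by
  refine ⟨(hf.smul _).add ((hf.rename_equiv _).smul _), ?_⟩
  have h0 : (0 : ℝ) ≤ ((m + 1 : ℕ) : ℝ) / ((m + 2 : ℕ) : ℝ) := by positivity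
  have h1 : ((m + 1 : ℕ) : ℝ) / ((m + 2 : ℕ) : ℝ) ≤ 1 :=
    (div_le_one (by positivity)).2 (Nat.cast_le.2 (by omega))
  have h := hs.partialSymmetrization hf j k h0 h1
  have hc : ((((m + 1 : ℕ) : ℝ) / ((m + 2 : ℕ) : ℝ) : ℝ) : ℂ) = ((m + 1 : ℕ) : ℂ) / ((m + 2 : ℕ) : ℂ) := by
    push_cast
    rfl
  rwa [hc] at h

/-- The insertion scheme keeps a multi-affine polynomial multi-affine and stable.
[cite: BorceaBranden2009II, §1 Prop. 1.3 (a) and proof of Thm. 1.2] -/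
theorem IsUpperHalfPlaneStable.insertionOp {f : MvPolynomial σ ℂ} (hf : IsMultiAffine f)
    (hs : IsUpperHalfPlaneStable f) (k : σ) (l : List σ) :
    IsMultiAffine (StablePolynomials.insertionOp k l f) ∧
      IsUpperHalfPlaneStable (StablePolynomials.insertionOp k l f) := by
  induction l generalizing f with
  | nil => exact ⟨hf, hs⟩
  | cons j l ih =>
    rw [insertionOp_cons]
    have h := hs.partialSymmetrization_nat hf j k l.length
    exact ih h.1 h.2

/-- Sequential symmetrization keeps a multi-affine polynomial multi-affine and stable.
[cite: BorceaBranden2009II, §1 proof of Thm. 1.2] -/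
theorem IsUpperHalfPlaneStable.seqSymmetrization {f : MvPolynomial σ ℂ} (hf : IsMultiAffine f)
    (hs : IsUpperHalfPlaneStable f) (l : List σ) :
    IsMultiAffine (StablePolynomials.seqSymmetrization l f) ∧
      IsUpperHalfPlaneStable (StablePolynomials.seqSymmetrization l f) := by
  induction l with
  | nil => exact ⟨hf, hs⟩
  | cons k l ih =>
    rw [seqSymmetrization_cons]
    exact ih.2.insertionOp ih.1 k l

/-- **Borcea–Brändén II, Theorem 1.2 (a), for the open upper half-plane**: "If `C` is convex then
the symmetrization operator `Sym` preserves `C`-stability on multi-affine polynomials" — if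
`f ∈ ℂ[z_σ]` is multi-affine and stable (no zeros in `H^σ`) then so is
`Sym f = (n!)⁻¹ Σ_{π ∈ 𝔖_σ} π(f)`. Proof: `Sym f` is the result of finitely many partial
symmetrizations `θ·id + (1-θ)·τ` (`θ ∈ [0,1]`, `τ` a transposition), each of which preserves
stability of multi-affine polynomials (Prop. 1.3 (a) = Borcea–Brändén–Liggett Thm. 4.20).
[cite: BorceaBranden2009II, §1 Thm. 1.2 (a) (case C = H)] -/
theorem IsUpperHalfPlaneStable.symmetrization {f : MvPolynomial σ ℂ} (hf : IsMultiAffine f)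
    (hs : IsUpperHalfPlaneStable f) : IsUpperHalfPlaneStable (StablePolynomials.symmetrization f) := by
  rw [← seqSymmetrization_toList_univ]
  exact (hs.seqSymmetrization hf _).2

/-- `Sym` of a stable multi-affine polynomial is nonzero. [cite: BorceaBranden2009II, §1 Thm. 1.2
(a)] -/
theorem IsUpperHalfPlaneStable.symmetrization_ne_zero {f : MvPolynomial σ ℂ} (hf : IsMultiAffine f)
    (hs : IsUpperHalfPlaneStable f) : StablePolynomials.symmetrization f ≠ 0 := fun h =>
  hs.symmetrization hf (fun _ => Complex.I) (fun _ => by simp) (by rw [h, map_zero])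

/-- Complexification commutes with `Sym` (the operator has rational coefficients).
[cite: BorceaBranden2009II, §1 (definition of Sym)] -/
theorem map_algebraMap_symmetrization (f : MvPolynomial σ ℝ) :
    MvPolynomial.map (algebraMap ℝ ℂ) (symmetrization f) =
      symmetrization (MvPolynomial.map (algebraMap ℝ ℂ) f) := by
  rw [symmetrization_apply, symmetrization_apply, smul_eq_C_mul, map_mul, map_C, map_sum,
    smul_eq_C_mul]
  congr 1
  · rw [map_inv₀, map_natCast]
  · exact sum_congr rfl fun e _ => map_rename _ _ _

/-- **Theorem 1.2 (a) for real stable polynomials**: `Sym f` is real stable for every real stable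
multi-affine `f ∈ ℝ[z_σ]`. [cite: BorceaBranden2009II, §1 Thm. 1.2 (a) (case C = H, real
coefficients)] -/
theorem IsRealStable.symmetrization {f : MvPolynomial σ ℝ} (hf : IsMultiAffine f)
    (hs : IsRealStable f) : IsRealStable (StablePolynomials.symmetrization f) := by
  rw [IsRealStable, map_algebraMap_symmetrization]
  exact IsUpperHalfPlaneStable.symmetrization (isMultiAffine_map_algebraMap hf) hs

end Stability

end Literature.Combinatorics.StablePolynomials

end
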